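import Mathlib

/-!
# Stub `stub_arith` of line `Sketch` for crux `WordLengthQP` (stmt-ValiantsHypothesis-6623)

Pure exponent bookkeeping for the converse transfer `X → EpsOrderLadder` of the skeleton of line
`Sketch` (idea `eps-order-ladder`): the word length produced at budget `2^((x + c)^c)`, namely
`(B·B + B + 1)·(2·1 + 2·(2·8^E))` with `B := 2^E`, `E := (x + c)^c`, is again quasi-polynomially
bounded, `≤ 2^((x + c')^c')`, with `c' := c + 10`.

Proof: with `y := (x + c)^c ≥ 1` and `a := 2^y ≥ 1` one has `8^y = a^3`, so the left-hand side is
`(a·a + a + 1)·(2 + 4·a^3) ≤ 3a^2 · 6a^3 = 18 a^5 ≤ 32 a^5 = 2^(5y + 5)`, and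
`5y + 5 ≤ 10·y ≤ (x + c + 10)^c · (x + c + 10)^10 = (x + c + 10)^(c + 10)`.
-/

-- `Summit.ValiantsHypothesis.ValiantsHypothesis.…` is the tree's mandated single-conjunct layout
-- (Sub = Summit), so the duplicated namespace component is intended.
set_option linter.dupNamespace false

namespace Summit.ValiantsHypothesis.ValiantsHypothesis.Cruxes.WordLengthQP.EpsOrderLadder

/-- Polynomial core of the bookkeeping: for `1 ≤ a`,
`(a·a + a + 1)·(2·1 + 2·(2·a^3)) ≤ 32·a^5`. -/
theorem arith_ladder_poly_bound (a : ℕ) (ha : 1 ≤ a) :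
    (a * a + a + 1) * (2 * 1 + 2 * (2 * a ^ 3)) ≤ 32 * a ^ 5 := by
  have h1 : a * a + a + 1 ≤ 3 * (a * a) := by nlinarith
  have h3 : 1 ≤ a ^ 3 := Nat.one_le_pow _ _ (by omega)
  have h2 : 2 * 1 + 2 * (2 * a ^ 3) ≤ 6 * a ^ 3 := by omega
  calc (a * a + a + 1) * (2 * 1 + 2 * (2 * a ^ 3))
      ≤ 3 * (a * a) * (6 * a ^ 3) := Nat.mul_le_mul h1 h2
    _ = 18 * a ^ 5 := by ring
    _ ≤ 32 * a ^ 5 := by omega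

/-- Exponential form of the bookkeeping: with `y` in place of `(x + c)^c`, the word length is
`≤ 2^(5y + 5)`. -/
theorem arith_ladder_two_pow_bound (y : ℕ) :
    (2 ^ y * 2 ^ y + 2 ^ y + 1) * (2 * 1 + 2 * (2 * 8 ^ y)) ≤ 2 ^ (5 * y + 5) := by
  obtain ⟨a, ha⟩ : ∃ a : ℕ, 2 ^ y = a := ⟨_, rfl⟩
  have ha1 : 1 ≤ a := ha ▸ Nat.one_le_two_pow
  have h8 : (8 : ℕ) ^ y = a ^ 3 := by
    rw [← ha, pow_right_comm]
    norm_num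
  have h32 : (2 : ℕ) ^ (5 * y + 5) = 32 * a ^ 5 := by
    rw [pow_add, pow_mul, pow_right_comm, ha]
    ring
  rw [h8, h32, ha]
  exact arith_ladder_poly_bound a ha1

/-- Exponent comparison: `5·(x + c)^c + 5 ≤ (x + (c + 10))^(c + 10)`. -/
theorem arith_ladder_exp_bound (c x : ℕ) :
    5 * (x + c) ^ c + 5 ≤ (x + (c + 10)) ^ (c + 10) := by
  have hy1 : 1 ≤ (x + c) ^ c := by
    rcases Nat.eq_zero_or_pos c with rfl | hc
    · simp
    · exact Nat.one_le_pow _ _ (by omega)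
  have hA : (x + c) ^ c ≤ (x + (c + 10)) ^ c := Nat.pow_le_pow_left (by omega) c
  have hB : 10 ≤ (x + (c + 10)) ^ 10 :=
    calc 10 ≤ x + (c + 10) := by omega
      _ ≤ (x + (c + 10)) ^ 10 := Nat.le_self_pow (by norm_num) _
  calc 5 * (x + c) ^ c + 5
      ≤ (x + c) ^ c * 10 := by omega
    _ ≤ (x + (c + 10)) ^ c * (x + (c + 10)) ^ 10 := Nat.mul_le_mul hA hB
    _ = (x + (c + 10)) ^ (c + 10) := (pow_add _ _ _).symm

/-- **stub_arith** (exponent bookkeeping): the word length produced by the converse transfer at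
budget `2^((x + c)^c)` is again quasi-polynomial, `≤ 2^((x + c')^c')` (here `c' := c + 10`). -/
theorem stub_arith (c : ℕ) : ∃ c' : ℕ, ∀ x : ℕ,
    (2 ^ ((x + c) ^ c) * 2 ^ ((x + c) ^ c) + 2 ^ ((x + c) ^ c) + 1) *
      (2 * 1 + 2 * (2 * 8 ^ ((x + c) ^ c))) ≤ 2 ^ ((x + c') ^ c') :=
  ⟨c + 10, fun x => (arith_ladder_two_pow_bound ((x + c) ^ c)).trans
    (Nat.pow_le_pow_right (by norm_num) (arith_ladder_exp_bound c x))⟩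

end Summit.ValiantsHypothesis.ValiantsHypothesis.Cruxes.WordLengthQP.EpsOrderLadder
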